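import Literature.NumberTheory.Sieve.AsymptoticSieveForPrimesLoglog
import Literature.NumberTheory.Sieve.AsymptoticSieveForPrimesCancellation
import HarnessLib

/-!
# Asymptotic sieve for primes: discharge of the intermediate named facts (4.5), (5.1), (8.5), (1.13)–(1.14)

Trunk T-SIEVE, companion ("Proofs") file of `AsymptoticSieveForPrimesDecomposition.lean` and
`AsymptoticSieveForPrimesInputs.lean`. Source: J. Friedlander, H. Iwaniec, *Asymptotic sieve for
primes*, Ann. of Math. 148 (1998) 1041–1065 [FriedlanderIwaniecASP1998] (= arXiv:math/9811186).

The series `AsymptoticSieveForPrimes*` states four intermediate results of FI's proof of Theorem 1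
as named facts and proves each of them *modulo FI (2.4)* (`fi_moebius_density_cancellation`,
`…Inputs`):

| named fact (`def … : Prop`)              | source            | proved modulo (2.4) in                         |
|------------------------------------------|-------------------|------------------------------------------------|
| `fi_moebius_density_log_sum` (`…Inputs`) | FI (1.12)–(1.14)  | `…LogSumIdentity`: `fi_moebius_density_log_sum_of_cancellation` |
| `fi_asp_Tyz_estimate` (`…Decomposition`) | FI §5 (5.1)       | `…Tyz`: `fi_asp_Tyz_estimate_of_cancellation`  |
| `fi_asp_T_estimate` (`…Decomposition`)   | FI §4 (4.5)       | `…T`: `fi_asp_T_estimate_of_cancellation`      |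
| `fi_asp_S3_estimate` (`…Decomposition`)  | FI §8 (8.5)       | `…S3Assembly`: `fi_asp_S3_estimate_of_cancellation` |

FI (2.4) itself is proved in `…Cancellation` (`fi_moebius_density_cancellation_holds`, from the
tree's de la Vallée Poussin prime number theorem via `∑_{n ≤ x} μ(n)/n ≪ e^{-c√log x}`, Mertens'
theorems with log-power error, Rankin's trick and FI's comparison argument of pp. 1048–1049).
This file records the resulting unconditional discharges under the canonical names `<fact>_holds`.
(Theorem 1 itself, `fi_asymptotic_sieve_primes_loglog_holds`, is recorded in
`AsymptoticSieveForPrimesTheorem1.lean`; the other three named facts of the assembly,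
`brun_upperSieveWeights`, `fi_asp_S1_estimate`, `fi_asp_S2_estimate`, are discharged in `…Brun`,
`…S1`, `…S2`.)

## Mathlib search

Nothing to search: compositions of theorems of this series (`lean search
'fi_asp_(T|Tyz|S3)_estimate_holds|fi_moebius_density_log_sum_holds' --decl`: no declaration before
this file).
-/

noncomputable section

namespace Literature.NumberTheory.Sieve

/-- **FI (1.13)–(1.14), PROVED**: for a multiplicative `g` with `0 ≤ g(p) < 1`, (1.8) and (1.9),
and `H` the limit of `∏_{p ≤ x} (1 - g(p))(1 - 1/p)⁻¹`, the series `∑_d μ(d) g(d) log d` converges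
to `-H`. Unconditional: `fi_moebius_density_log_sum_of_cancellation` (`…LogSumIdentity`) applied to
`fi_moebius_density_cancellation_holds` (`…Cancellation`).
[cite: FriedlanderIwaniecASP1998, (1.12)–(1.14), p. 1043] -/
theorem fi_moebius_density_log_sum_holds : fi_moebius_density_log_sum :=
  fi_moebius_density_log_sum_of_cancellation fi_moebius_density_cancellation_holds

/-- **FI (5.1), PROVED**: `T(x; y, z) ≪ A(x)(log x)^{-2}` in the regime of the decomposition
(`…Decomposition`). Unconditional: `fi_asp_Tyz_estimate_of_cancellation` (`…Tyz`) applied to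
`fi_moebius_density_cancellation_holds`.
[cite: FriedlanderIwaniecASP1998, §5, (5.1), p. 1054] -/
theorem fi_asp_Tyz_estimate_holds : fi_asp_Tyz_estimate :=
  fi_asp_Tyz_estimate_of_cancellation fi_moebius_density_cancellation_holds

/-- **FI (4.5), PROVED**: `T(x; y) = H A(x) + O(A(x)(log x)^{-2})` in the regime of the
decomposition (`…Decomposition`). Unconditional: `fi_asp_T_estimate_of_cancellation` (`…T`)
applied to `fi_moebius_density_cancellation_holds` and `fi_moebius_density_log_sum_holds`.
[cite: FriedlanderIwaniecASP1998, §4, (4.5), p. 1054] -/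
theorem fi_asp_T_estimate_holds : fi_asp_T_estimate :=
  fi_asp_T_estimate_of_cancellation fi_moebius_density_cancellation_holds
    fi_moebius_density_log_sum_holds

/-- **FI (8.5), PROVED**: `∫_Z^{eZ} S₃(x; y, z) dz/z ≪ A(x)/log x` in the regime of the
decomposition (`…Decomposition`). Unconditional: `fi_asp_S3_estimate_of_cancellation`
(`…S3Assembly`) applied to `fi_moebius_density_cancellation_holds`.
[cite: FriedlanderIwaniecASP1998, §8, (8.5), p. 1058] -/
theorem fi_asp_S3_estimate_holds : fi_asp_S3_estimate :=
  fi_asp_S3_estimate_of_cancellation fi_moebius_density_cancellation_holds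

end Literature.NumberTheory.Sieve
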